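import Literature.MathematicalPhysics.QuantumFieldTheory.O2NeutralSectorsTail
import Literature.MathematicalPhysics.QuantumFieldTheory.ConformalBootstrap3D.MixedHeadBound
import HarnessLib

/-!
# O(2) scan, neutral sectors `0±`: cells that START AT THE UNITARITY BOUND (monotone tables)

The cell rules of `O2NeutralSectorsCells` (`pos0p_on_cell_Ico`, `pos0m_on_cell_Ico`) use the interval
tables `hrCoeffLo/Hi` of the Hogervorst–Rychkov coefficients and therefore need a cell `[a, b)` with
`a > unitarityBound3D ℓ`. Two items of the O(2) scan obligations (`O2Obligations`) sit exactly AT the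
bound `Δ = ℓ + 1`: the stress tensor `(ℓ, Δ) = (2, 3)` in sector `0⁺` (`stress_0p`) and the conserved
current `(ℓ, Δ) = (1, 2)` in sector `0⁻` (`current_0m`). As in the `σ–ε` system
(`ConformalBootstrap3D.MixedHeadBound`, even sector), the equal-dimension coefficient arrays `A_{n,j}(Δ)`
have no pole at the bound and admit the MONOTONE tables
`A_{n,j}(Δ) ∈ [A_{n,j}(a) π_n(a)/π_n(b), A_{n,j}(b) π_n(b)/π_n(a)]` on `ℓ + 1 ≤ a ≤ Δ ≤ b`
(`hrCoeff_monotone_sandwich`), so the same head-matrix argument runs on a BOUND CELL `[a, b)` with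
`a ≥ ℓ + 1`; the bound itself (a non-regular point) is reached by the right-limit clause inside the cell.

* §1 tables for weighted sums with the monotone tables (`headCellSumM_le_sum`, `abs_sum_le_headAbsSumM`);
* §2 the `0⁺` bound-cell rule: `sector0pForm_nonneg_on_boundCell` (regular points),
  `pos0p_on_boundCell_Ico` (every `Δ ∈ [a, b)`), and with kernel-computed corner tables
  `pos0p_on_boundCell_Ico_of_corners`; the stress-tensor item `stress_0p_of_boundCell`
  (`Pos0p F D 3 2` from any bound cell `[3, b)`, `b > 3`);
* §3 the `0⁻` bound-cell rule (closed-form `2 × 2` numbers): `sector0mForm_nonneg_on_boundCell`,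
  `pos0m_on_boundCell_Ico`, `pos0m_on_boundCell_Ico_of_corners`; the current item
  `current_0m_of_boundCell` (`Pos0m F D 2 1` from any bound cell `[2, b)`, `b > 2`).

What a reader supplies for the two conserved-operator items: a head set `S`, a cell end `b`, and the
vertex / closed-form checks on the kernel-computed numbers; the tails come from the (M)/(T) facts of
`O2NeutralSectorsTail` (`cellTail0p_of_termwise`, `cellTail0m_of_termwise`). This is R-07.5 PLANNING for
the O(2) client path: Lean statements a JSON-kind reader would have to discharge; no numerics here.

References: Chester–Landry–Liu–Poland–Simmons-Duffin–Su–Vichi, JHEP 06 (2020) 142, §3.1 (functional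
conditions incl. the stress tensor and the current) (`ChesterEtAl2020`); Hogervorst–Rychkov, Phys. Rev.
D 87 (2013) 106004, §3 eqs. (3.6), (3.9) (`HogervorstRychkov2013`); Kos–Poland–Simmons-Duffin, JHEP 11
(2014) 109, §3.3 eq. (3.16), §4 eqs. (4.2)–(4.3) (`KosPolandSimmonsduffin2014`); Dolan–Osborn,
Nucl. Phys. B 678 (2004) 491, §3 eq. (3.11) (`DolanOsborn2004`); Hladík (2017), Thm. 1 (`Hladik2017`).
-/

namespace Literature.MathematicalPhysics.QuantumFieldTheory.O2NeutralSectorsBoundCells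

open Finset Set Matrix Filter Topology
open Literature.MathematicalPhysics.QuantumFieldTheory.O2ThreeScalarCrossing
open Literature.MathematicalPhysics.QuantumFieldTheory.O2ThreeScalarSystem
open Literature.MathematicalPhysics.QuantumFieldTheory.O2OPEScanBridge
open Literature.MathematicalPhysics.QuantumFieldTheory.O2ScanObligations
open Literature.MathematicalPhysics.QuantumFieldTheory.O2NeutralSectorsTermwise
open Literature.MathematicalPhysics.QuantumFieldTheory.O2NeutralSectorsHead
open Literature.MathematicalPhysics.QuantumFieldTheory.O2NeutralSectorsCells
open Literature.MathematicalPhysics.QuantumFieldTheory.O2NeutralSectorsTail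
open Literature.Analysis.ValidatedNumerics.ParametricIntervalPosSemidef (signRadMatrix
  posSemidef_of_forall_signRadMatrix posSemidef_symm_fin_two_of_bounds)
open ConformalBootstrap3D (IsConformalBlock3D IsRegularPoint3D unitarityBound3D accidentalDegeneracy3D
  hrCoeff legendreLam InDescendantRange legendreLam_pos hrCoeffMLo hrCoeffMHi hrCoeff_monotone_sandwich
  headCellSumM headAbsSumM min_mul_le_mul_of_bounds eventually_isRegularPoint3D_nhdsGT_of_bound_le
  unitarityBound3D_le_add_one zMono twoWeightEval cornerBound₂)

/-! ### §1 Weighted sums with the monotone tables -/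

/-- **Lower monotone table for a weighted sum** (cell `[a, b]`, `a ≥ ℓ + 1`): if `Φlo_q ≤ m_q` then
`headCellSumM ℓ a b S Φlo ≤ Σ_{q ∈ S} A_q(Δ) m_q` for `Δ ∈ [a, b]`. [cite: HogervorstRychkov2013, §3 eq. (3.9)]
[cite: DolanOsborn2004, §3 eq. (3.11)] -/
theorem headCellSumM_le_sum {ℓ : ℕ} {a b Δ : ℝ} (ha : (ℓ : ℝ) + 1 ≤ a) (hΔ : Δ ∈ Icc a b)
    (S : Finset (ℕ × ℕ)) (Φlo m : ℕ × ℕ → ℝ) (hΦ : ∀ q ∈ S, Φlo q ≤ m q) :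
    headCellSumM ℓ a b S Φlo ≤ ∑ q ∈ S, hrCoeff Δ ℓ q.1 q.2 * m q := by
  refine Finset.sum_le_sum fun q hq => ?_
  have hA := hrCoeff_monotone_sandwich ha hΔ.1 hΔ.2 q.1 q.2
  exact min_mul_le_mul_of_bounds hA.2.1 hA.2.2 (hA.1.trans hA.2.1) (hΦ q hq)

/-- **Absolute monotone table for a weighted sum**: if `|m_q| ≤ R_q` then
`|Σ_{q ∈ S} A_q(Δ) m_q| ≤ headAbsSumM ℓ a b S R` for `Δ ∈ [a, b]`. [cite: HogervorstRychkov2013, §3 eq. (3.9)]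
[cite: DolanOsborn2004, §3 eq. (3.11)] -/
theorem abs_sum_le_headAbsSumM {ℓ : ℕ} {a b Δ : ℝ} (ha : (ℓ : ℝ) + 1 ≤ a) (hΔ : Δ ∈ Icc a b)
    (S : Finset (ℕ × ℕ)) (R m : ℕ × ℕ → ℝ) (hR : ∀ q ∈ S, |m q| ≤ R q) :
    |∑ q ∈ S, hrCoeff Δ ℓ q.1 q.2 * m q| ≤ headAbsSumM ℓ a b S R := by
  refine (Finset.abs_sum_le_sum_abs _ _).trans (Finset.sum_le_sum fun q hq => ?_)
  have hA := hrCoeff_monotone_sandwich ha hΔ.1 hΔ.2 q.1 q.2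
  have hA0 : 0 ≤ hrCoeff Δ ℓ q.1 q.2 := hA.1.trans hA.2.1
  rw [abs_mul, abs_of_nonneg hA0]
  exact (mul_le_mul_of_nonneg_left (hR q hq) hA0).trans
    (mul_le_mul_of_nonneg_right hA.2.2 ((abs_nonneg _).trans (hR q hq)))

/-! ### §2 The `0⁺` bound-cell rule and the stress tensor -/

/-- `lo ≤ x ≤ hi ⇒ |x| ≤ max (−lo) hi` (private helper). [folklore] -/
private theorem boundCells_abs_le_max {x lo hi : ℝ} (h1 : lo ≤ x) (h2 : x ≤ hi) :
    |x| ≤ max (-lo) hi := by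
  rw [abs_le]
  exact ⟨by linarith [le_max_left (-lo) hi], h2.trans (le_max_right _ _)⟩

/-- **`0⁺` BOUND-CELL RULE, regular points** (cell `[a, b]`, `a ≥ ℓ + 1`, monotone tables): entry tables
valid on the cell, the four sign–radius matrices of `(headCellSumM … (Φlo i), headAbsSumM … (R i k))` PSD,
tail term matrices PSD on `E ∈ [a+n, b+n]` ⇒ the `0⁺` form is `≥ 0` on genuine blocks at every REGULAR
`Δ ∈ [a, b]`. [cite: KosPolandSimmonsduffin2014, §3.3 eq. (3.16)] [cite: Hladik2017, Thm. 1 ((2) ⇒ (1))]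
[cite: HogervorstRychkov2013, §3 eqs. (3.6), (3.9)] -/
theorem sector0pForm_nonneg_on_boundCell (F : ScanFunctional) (D : Dims) {ℓ : ℕ} {a b : ℝ}
    (ha : (ℓ : ℝ) + 1 ≤ a) (S : Finset (ℕ × ℕ)) (Φlo : Fin 3 → ℕ × ℕ → ℝ)
    (R : Fin 3 → Fin 3 → ℕ × ℕ → ℝ)
    (hΦ : ∀ q ∈ S, ∀ Δ ∈ Icc a b, ∀ i, Φlo i q ≤ termMatrix0p F D (Δ + (q.1 : ℝ)) q.2 i i)
    (hR : ∀ q ∈ S, ∀ Δ ∈ Icc a b, ∀ i k, i ≠ k → |termMatrix0p F D (Δ + (q.1 : ℝ)) q.2 i k| ≤ R i k q)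
    (hvert : ∀ z : Fin 3 → Bool, (signRadMatrix (fun i => headCellSumM ℓ a b S (Φlo i))
      (Matrix.of fun i k => headAbsSumM ℓ a b S (R i k)) z).PosSemidef)
    (htail : ∀ q : ℕ × ℕ, q ∉ S → InDescendantRange ℓ q.1 q.2 →
      ∀ E ∈ Icc (a + q.1) (b + q.1), (termMatrix0p F D E q.2).PosSemidef) :
    ∀ Δ ∈ Icc a b, IsRegularPoint3D Δ ℓ → ∀ G : Label → ℝ → ℝ → ℝ,
      (∀ L ∈ labels0p, IsConformalBlock3D 0 0 Δ ℓ (G L)) → ∀ x₁ x₂ x₃ : ℝ, 0 ≤ sector0pForm F D G x₁ x₂ x₃ := by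
  intro Δ hΔ hreg G hG x₁ x₂ x₃
  have hlam : 0 < legendreLam ℓ := legendreLam_pos ℓ
  set A := legendreLam ℓ • headMatrix0p F D Δ ℓ S with hAdef
  have hAh : A.IsHermitian := by
    unfold Matrix.IsHermitian
    rw [hAdef, Matrix.conjTranspose_smul, star_trivial, (isHermitian_headMatrix0p F D Δ ℓ S).eq]
  have hApsd : A.PosSemidef := by
    refine posSemidef_of_forall_signRadMatrix hvert hAh (fun i => ?_) (fun i k hik => ?_)
    · rw [hAdef, smul_headMatrix0p_apply]
      exact headCellSumM_le_sum ha hΔ S (Φlo i) _ fun q hq => hΦ q hq Δ hΔ i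
    · rw [Matrix.of_apply, hAdef, smul_headMatrix0p_apply]
      exact abs_sum_le_headAbsSumM ha hΔ S (R i k) _ fun q hq => hR q hq Δ hΔ i k hik
  have hH : headMatrix0p F D Δ ℓ S = (legendreLam ℓ)⁻¹ • A := by
    rw [hAdef, smul_smul, inv_mul_cancel₀ hlam.ne', one_smul]
  have hHpsd : (headMatrix0p F D Δ ℓ S).PosSemidef := by
    rw [hH]
    exact hApsd.smul (inv_nonneg.mpr hlam.le)
  have hlt : unitarityBound3D ℓ < Δ :=
    lt_of_le_of_ne (((unitarityBound3D_le_add_one ℓ).trans ha).trans hΔ.1) (Ne.symm hreg.1)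
  exact sector0pForm_nonneg_of_headMatrix F D hlt hreg.2 S hHpsd
    (fun q hq hr => htail q hq hr (Δ + (q.1 : ℝ)) ⟨by linarith [hΔ.1], by linarith [hΔ.2]⟩) hG x₁ x₂ x₃

/-- **`0⁺` BOUND-CELL RULE, half-open cell** `[a, b)`, `a ≥ ℓ + 1`: `Pos0p` at every `Δ ∈ [a, b)`; the
bound `Δ = ℓ + 1 = a` (non-regular) by the right-limit clause inside the cell.
[cite: KosPolandSimmonsduffin2014, §3.3 eq. (3.16), §4 eqs. (4.2)–(4.3)] [cite: ChesterEtAl2020, §3.1 (functional conditions)] -/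
theorem pos0p_on_boundCell_Ico (F : ScanFunctional) (D : Dims) {ℓ : ℕ} {a b : ℝ}
    (ha : (ℓ : ℝ) + 1 ≤ a) (S : Finset (ℕ × ℕ)) (Φlo : Fin 3 → ℕ × ℕ → ℝ)
    (R : Fin 3 → Fin 3 → ℕ × ℕ → ℝ)
    (hΦ : ∀ q ∈ S, ∀ Δ ∈ Icc a b, ∀ i, Φlo i q ≤ termMatrix0p F D (Δ + (q.1 : ℝ)) q.2 i i)
    (hR : ∀ q ∈ S, ∀ Δ ∈ Icc a b, ∀ i k, i ≠ k → |termMatrix0p F D (Δ + (q.1 : ℝ)) q.2 i k| ≤ R i k q)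
    (hvert : ∀ z : Fin 3 → Bool, (signRadMatrix (fun i => headCellSumM ℓ a b S (Φlo i))
      (Matrix.of fun i k => headAbsSumM ℓ a b S (R i k)) z).PosSemidef)
    (htail : ∀ q : ℕ × ℕ, q ∉ S → InDescendantRange ℓ q.1 q.2 →
      ∀ E ∈ Icc (a + q.1) (b + q.1), (termMatrix0p F D E q.2).PosSemidef) :
    ∀ Δ ∈ Ico a b, Pos0p F.toFunctional D Δ ℓ := by
  intro Δ hΔ
  have hcell := sector0pForm_nonneg_on_boundCell F D ha S Φlo R hΦ hR hvert htail
  by_cases hr : IsRegularPoint3D Δ ℓ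
  · exact pos0p_of_forall_sector0pForm_nonneg F D fun G hG => hcell Δ ⟨hΔ.1, hΔ.2.le⟩ hr G hG
  · have hbd : unitarityBound3D ℓ ≤ Δ := ((unitarityBound3D_le_add_one ℓ).trans ha).trans hΔ.1
    refine pos0p_of_eventually_right F D hr ?_
    filter_upwards [eventually_isRegularPoint3D_nhdsGT_of_bound_le hbd, Ioo_mem_nhdsGT hΔ.2]
      with Δ' hΔ'reg hΔ'
    exact ⟨hΔ'reg, fun G hG => hcell Δ' ⟨hΔ.1.trans hΔ'.1.le, hΔ'.2.le⟩ hΔ'reg G hG⟩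

/-- **`0⁺` bound-cell rule with corner tables** (the entry tables are the corner numbers
`boxLo0p/boxRad0p … j (a+n) (b+n)` of `O2NeutralSectorsTail`).
[cite: KosPolandSimmonsduffin2014, §3.3 eq. (3.16), §4 eqs. (4.2)–(4.3)] [cite: HogervorstRychkov2013, §3 eqs. (3.6), (3.9)]
[cite: Hladik2017, Thm. 1 ((2) ⇒ (1))] -/
theorem pos0p_on_boundCell_Ico_of_corners (F : ScanFunctional) (D : Dims) {ℓ : ℕ} {a b : ℝ}
    (ha : (ℓ : ℝ) + 1 ≤ a) (S : Finset (ℕ × ℕ))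
    (hvert : ∀ z : Fin 3 → Bool, (signRadMatrix
      (fun i => headCellSumM ℓ a b S (fun q => boxLo0p F D q.2 (a + q.1) (b + q.1) i))
      (Matrix.of fun i k => headAbsSumM ℓ a b S (fun q => boxRad0p F D q.2 (a + q.1) (b + q.1) i k))
        z).PosSemidef)
    (htail : ∀ q : ℕ × ℕ, q ∉ S → InDescendantRange ℓ q.1 q.2 →
      ∀ E ∈ Icc (a + q.1) (b + q.1), (termMatrix0p F D E q.2).PosSemidef) :
    ∀ Δ ∈ Ico a b, Pos0p F.toFunctional D Δ ℓ := by
  refine pos0p_on_boundCell_Ico F D ha S (fun i q => boxLo0p F D q.2 (a + q.1) (b + q.1) i)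
    (fun i k q => boxRad0p F D q.2 (a + q.1) (b + q.1) i k) (fun q _ Δ hΔ i => ?_)
    (fun q _ Δ hΔ i k _ => ?_) hvert htail
  · rw [boxLo0p, termMatrix0p_apply_eq_twoWeightEval]
    exact (twoWeightEval_mem_Icc_corner F _ _ q.2 (E := Δ + (q.1 : ℝ))
      ⟨by linarith [hΔ.1], by linarith [hΔ.2]⟩ _).1
  · rw [boxRad0p, Matrix.of_apply, termMatrix0p_apply_eq_twoWeightEval]
    have h := twoWeightEval_mem_Icc_corner F (cw0p F i k) (dw0p F i k) q.2 (E₁ := a + (q.1 : ℝ))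
      (E₂ := b + (q.1 : ℝ)) (E := Δ + (q.1 : ℝ)) ⟨by linarith [hΔ.1], by linarith [hΔ.2]⟩
      (D.expo (lab0p i k))
    exact boundCells_abs_le_max h.1 h.2

/-- **The stress-tensor item** `stress_0p` of `O2Obligations`: `Pos0p F D 3 2` from any `0⁺` bound cell
`[3, b)` at spin `2` (`b > 3`). [cite: ChesterEtAl2020, §3.1 (functional conditions)]
[cite: KosPolandSimmonsduffin2014, §3.3 eq. (3.16)] -/
theorem stress_0p_of_boundCell (F : ScanFunctional) (D : Dims) {b : ℝ} (hb : 3 < b)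
    (h : ∀ Δ ∈ Ico (3 : ℝ) b, Pos0p F.toFunctional D Δ 2) : Pos0p F.toFunctional D 3 2 :=
  h 3 ⟨le_rfl, hb⟩

/-! ### §3 The `0⁻` bound-cell rule and the conserved current -/

/-- **`0⁻` BOUND-CELL RULE, regular points** (`2 × 2`, closed form, monotone tables, `a ≥ ℓ + 1`).
[cite: KosPolandSimmonsduffin2014, §3.3 eq. (3.16)] [cite: HogervorstRychkov2013, §3 eqs. (3.6), (3.9)] -/
theorem sector0mForm_nonneg_on_boundCell (F : ScanFunctional) (D : Dims) {ℓ : ℕ} {a b : ℝ}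
    (ha : (ℓ : ℝ) + 1 ≤ a) (S : Finset (ℕ × ℕ)) (Φlo : Fin 2 → ℕ × ℕ → ℝ) (R : ℕ × ℕ → ℝ)
    (hΦ : ∀ q ∈ S, ∀ Δ ∈ Icc a b, ∀ i, Φlo i q ≤ termMatrix0m F D (Δ + (q.1 : ℝ)) q.2 i i)
    (hR : ∀ q ∈ S, ∀ Δ ∈ Icc a b, |termMatrix0m F D (Δ + (q.1 : ℝ)) q.2 0 1| ≤ R q)
    (hX : 0 ≤ headCellSumM ℓ a b S (Φlo 0)) (hY : 0 ≤ headCellSumM ℓ a b S (Φlo 1))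
    (hdet : headAbsSumM ℓ a b S R ^ 2 ≤ headCellSumM ℓ a b S (Φlo 0) * headCellSumM ℓ a b S (Φlo 1))
    (htail : ∀ q : ℕ × ℕ, q ∉ S → InDescendantRange ℓ q.1 q.2 →
      ∀ E ∈ Icc (a + q.1) (b + q.1), (termMatrix0m F D E q.2).PosSemidef) :
    ∀ Δ ∈ Icc a b, IsRegularPoint3D Δ ℓ → ∀ G : Label → ℝ → ℝ → ℝ,
      (∀ L ∈ labels0m, IsConformalBlock3D 0 0 Δ ℓ (G L)) → ∀ x₁ x₂ : ℝ, 0 ≤ sector0mForm F D G x₁ x₂ := by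
  intro Δ hΔ hreg G hG x₁ x₂
  have hlam : 0 < legendreLam ℓ := legendreLam_pos ℓ
  set A := legendreLam ℓ • headMatrix0m F D Δ ℓ S with hAdef
  have hsym : A 1 0 = A 0 1 := by
    have h := (isHermitian_headMatrix0m F D Δ ℓ S).apply 0 1
    rw [star_trivial] at h
    rw [hAdef, Matrix.smul_apply, Matrix.smul_apply, h]
  have hA2 : A = !![A 0 0, A 0 1; A 0 1, A 1 1] := by
    ext i k; fin_cases i <;> fin_cases k <;> simp [hsym]
  have h11 : headCellSumM ℓ a b S (Φlo 0) ≤ A 0 0 := by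
    rw [hAdef, smul_headMatrix0m_apply]
    exact headCellSumM_le_sum ha hΔ S (Φlo 0) _ fun q hq => hΦ q hq Δ hΔ 0
  have h22 : headCellSumM ℓ a b S (Φlo 1) ≤ A 1 1 := by
    rw [hAdef, smul_headMatrix0m_apply]
    exact headCellSumM_le_sum ha hΔ S (Φlo 1) _ fun q hq => hΦ q hq Δ hΔ 1
  have h12 : |A 0 1| ≤ headAbsSumM ℓ a b S R := by
    rw [hAdef, smul_headMatrix0m_apply]
    exact abs_sum_le_headAbsSumM ha hΔ S R _ fun q hq => hR q hq Δ hΔ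
  have hApsd : A.PosSemidef := by
    rw [hA2]
    refine posSemidef_symm_fin_two_of_bounds hX hY ?_ h11 h22 ⟨neg_le_of_abs_le h12, le_of_abs_le h12⟩
    rw [max_le_iff]
    constructor <;> nlinarith [hdet]
  have hH : headMatrix0m F D Δ ℓ S = (legendreLam ℓ)⁻¹ • A := by
    rw [hAdef, smul_smul, inv_mul_cancel₀ hlam.ne', one_smul]
  have hHpsd : (headMatrix0m F D Δ ℓ S).PosSemidef := by
    rw [hH]
    exact hApsd.smul (inv_nonneg.mpr hlam.le)
  have hlt : unitarityBound3D ℓ < Δ :=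
    lt_of_le_of_ne (((unitarityBound3D_le_add_one ℓ).trans ha).trans hΔ.1) (Ne.symm hreg.1)
  exact sector0mForm_nonneg_of_headMatrix F D hlt hreg.2 S hHpsd
    (fun q hq hr => htail q hq hr (Δ + (q.1 : ℝ)) ⟨by linarith [hΔ.1], by linarith [hΔ.2]⟩) hG x₁ x₂

/-- **`0⁻` BOUND-CELL RULE, half-open cell** `[a, b)`, `a ≥ ℓ + 1`.
[cite: KosPolandSimmonsduffin2014, §3.3 eq. (3.16), §4 eqs. (4.2)–(4.3)] [cite: ChesterEtAl2020, §3.1 (functional conditions)] -/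
theorem pos0m_on_boundCell_Ico (F : ScanFunctional) (D : Dims) {ℓ : ℕ} {a b : ℝ}
    (ha : (ℓ : ℝ) + 1 ≤ a) (S : Finset (ℕ × ℕ)) (Φlo : Fin 2 → ℕ × ℕ → ℝ) (R : ℕ × ℕ → ℝ)
    (hΦ : ∀ q ∈ S, ∀ Δ ∈ Icc a b, ∀ i, Φlo i q ≤ termMatrix0m F D (Δ + (q.1 : ℝ)) q.2 i i)
    (hR : ∀ q ∈ S, ∀ Δ ∈ Icc a b, |termMatrix0m F D (Δ + (q.1 : ℝ)) q.2 0 1| ≤ R q)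
    (hX : 0 ≤ headCellSumM ℓ a b S (Φlo 0)) (hY : 0 ≤ headCellSumM ℓ a b S (Φlo 1))
    (hdet : headAbsSumM ℓ a b S R ^ 2 ≤ headCellSumM ℓ a b S (Φlo 0) * headCellSumM ℓ a b S (Φlo 1))
    (htail : ∀ q : ℕ × ℕ, q ∉ S → InDescendantRange ℓ q.1 q.2 →
      ∀ E ∈ Icc (a + q.1) (b + q.1), (termMatrix0m F D E q.2).PosSemidef) :
    ∀ Δ ∈ Ico a b, Pos0m F.toFunctional D Δ ℓ := by
  intro Δ hΔ
  have hcell := sector0mForm_nonneg_on_boundCell F D ha S Φlo R hΦ hR hX hY hdet htail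
  by_cases hr : IsRegularPoint3D Δ ℓ
  · exact pos0m_of_forall_sector0mForm_nonneg F D fun G hG => hcell Δ ⟨hΔ.1, hΔ.2.le⟩ hr G hG
  · have hbd : unitarityBound3D ℓ ≤ Δ := ((unitarityBound3D_le_add_one ℓ).trans ha).trans hΔ.1
    refine pos0m_of_eventually_right F D hr ?_
    filter_upwards [eventually_isRegularPoint3D_nhdsGT_of_bound_le hbd, Ioo_mem_nhdsGT hΔ.2]
      with Δ' hΔ'reg hΔ'
    exact ⟨hΔ'reg, fun G hG => hcell Δ' ⟨hΔ.1.trans hΔ'.1.le, hΔ'.2.le⟩ hΔ'reg G hG⟩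

/-- **`0⁻` bound-cell rule with corner tables** (closed form on the head-cell sums of the corner numbers).
[cite: KosPolandSimmonsduffin2014, §3.3 eq. (3.16), §4 eqs. (4.2)–(4.3)] [cite: HogervorstRychkov2013, §3 eqs. (3.6), (3.9)] -/
theorem pos0m_on_boundCell_Ico_of_corners (F : ScanFunctional) (D : Dims) {ℓ : ℕ} {a b : ℝ}
    (ha : (ℓ : ℝ) + 1 ≤ a) (S : Finset (ℕ × ℕ))
    (hX : 0 ≤ headCellSumM ℓ a b S (fun q => cornerBound₂ (cw0m F 0 0) (dw0m F 0 0) F.z F.zb q.2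
      (a + q.1) (b + q.1) (D.expo (lab0m 0 0)) (D.expo (lab0m 0 0))))
    (hY : 0 ≤ headCellSumM ℓ a b S (fun q => cornerBound₂ (cw0m F 1 1) (dw0m F 1 1) F.z F.zb q.2
      (a + q.1) (b + q.1) (D.expo (lab0m 1 1)) (D.expo (lab0m 1 1))))
    (hdet : headAbsSumM ℓ a b S (fun q =>
        max (-cornerBound₂ (cw0m F 0 1) (dw0m F 0 1) F.z F.zb q.2 (a + q.1) (b + q.1) (D.expo (lab0m 0 1))
            (D.expo (lab0m 0 1)))
          (-cornerBound₂ (-cw0m F 0 1) (-dw0m F 0 1) F.z F.zb q.2 (a + q.1) (b + q.1) (D.expo (lab0m 0 1))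
            (D.expo (lab0m 0 1)))) ^ 2 ≤
      headCellSumM ℓ a b S (fun q => cornerBound₂ (cw0m F 0 0) (dw0m F 0 0) F.z F.zb q.2
          (a + q.1) (b + q.1) (D.expo (lab0m 0 0)) (D.expo (lab0m 0 0))) *
        headCellSumM ℓ a b S (fun q => cornerBound₂ (cw0m F 1 1) (dw0m F 1 1) F.z F.zb q.2
          (a + q.1) (b + q.1) (D.expo (lab0m 1 1)) (D.expo (lab0m 1 1))))
    (htail : ∀ q : ℕ × ℕ, q ∉ S → InDescendantRange ℓ q.1 q.2 →
      ∀ E ∈ Icc (a + q.1) (b + q.1), (termMatrix0m F D E q.2).PosSemidef) :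
    ∀ Δ ∈ Ico a b, Pos0m F.toFunctional D Δ ℓ := by
  refine pos0m_on_boundCell_Ico F D ha S
    (fun i q => cornerBound₂ (cw0m F i i) (dw0m F i i) F.z F.zb q.2 (a + q.1) (b + q.1)
      (D.expo (lab0m i i)) (D.expo (lab0m i i)))
    (fun q => max (-cornerBound₂ (cw0m F 0 1) (dw0m F 0 1) F.z F.zb q.2 (a + q.1) (b + q.1)
        (D.expo (lab0m 0 1)) (D.expo (lab0m 0 1)))
      (-cornerBound₂ (-cw0m F 0 1) (-dw0m F 0 1) F.z F.zb q.2 (a + q.1) (b + q.1) (D.expo (lab0m 0 1))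
        (D.expo (lab0m 0 1))))
    (fun q _ Δ hΔ i => ?_) (fun q _ Δ hΔ => ?_) hX hY hdet htail
  · rw [termMatrix0m_apply_eq_twoWeightEval]
    exact (twoWeightEval_mem_Icc_corner F _ _ q.2 (E := Δ + (q.1 : ℝ))
      ⟨by linarith [hΔ.1], by linarith [hΔ.2]⟩ _).1
  · rw [termMatrix0m_apply_eq_twoWeightEval]
    have h := twoWeightEval_mem_Icc_corner F (cw0m F 0 1) (dw0m F 0 1) q.2 (E₁ := a + (q.1 : ℝ))
      (E₂ := b + (q.1 : ℝ)) (E := Δ + (q.1 : ℝ)) ⟨by linarith [hΔ.1], by linarith [hΔ.2]⟩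
      (D.expo (lab0m 0 1))
    exact boundCells_abs_le_max h.1 h.2

/-- **The conserved-current item** `current_0m` of `O2Obligations`: `Pos0m F D 2 1` from any `0⁻` bound
cell `[2, b)` at spin `1` (`b > 2`). [cite: ChesterEtAl2020, §3.1 (functional conditions)]
[cite: KosPolandSimmonsduffin2014, §3.3 eq. (3.16)] -/
theorem current_0m_of_boundCell (F : ScanFunctional) (D : Dims) {b : ℝ} (hb : 2 < b)
    (h : ∀ Δ ∈ Ico (2 : ℝ) b, Pos0m F.toFunctional D Δ 1) : Pos0m F.toFunctional D 2 1 :=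
  h 2 ⟨le_rfl, hb⟩

end Literature.MathematicalPhysics.QuantumFieldTheory.O2NeutralSectorsBoundCells
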